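import Mathlib
import Summits.Ventures.PercRepro2.HCovSwap
import Summits.Ventures.PercRepro2.BHKAvoid
import Summits.Ventures.PercRepro2.OrderPreservation
import Summits.Ventures.PercRepro2.RootLeafA3
import Summits.Ventures.PercRepro2.RootLeafOCells
import Summits.Ventures.PercRepro2.RootLeafBEvents
import Summits.Ventures.PercRepro2.RootLeafBCells
import Summits.Ventures.PercRepro2.RootLeafBAtoms1
import Summits.Ventures.PercRepro2.RootLeafBAtoms2

/-!
# A ROOT as a leaf at `b`, part 6: the identity `Gc_root_leaf_b` (blind cell PercRepro2, p4 g2; S3 GAP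
(G4), the third root-leaf class: proofs/subclaims/S3-CLASSES.md §S3.10 (G4-b), proofs/P4-ROOTLEAF-B.md)

Let the root `a₁` be a LEAF attached to `b` by the single edge `f` of weight `q = p f`, with
`a₂, a₃, o ≠ a₁` (`G − a₁` arbitrary).  In the `(b, a₂)`-world of `G − a₁` (`Q = {b ↮ a₂}`,
`Z = P(Q)`, `L = C(b)`, `H = C(a₂)`, `N` = neither, `D₁ = P(Q, a₃ ∈ N)`, `X_L = P(Q, a₃ ∈ L)`,
`X_H = P(Q, a₃ ∈ H)`, `M_st = P(Q, o ∈ s, a₃ ∈ t)`, `d₀ = P(a₃ ↮ a₂)`, `e₀ = P(o ↔ a₂, a₃ ↮ a₂)`,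
`hb = P(b ↔ a₂)`, `S = P(Ω)`):

* **`Gc_root_leaf_b`**: `S·Gc = q(1−q)²·S·U + q²(1−q)·2·S·C` with `U` p4 g0's first coefficient
  (`2S[d₀·P(oH,bH,a₃∉H) − e₀·P(bH,a₃∉H)] + 2hb[e₀·X_L − d₀·M_HL] + 2S·d₀·M_LH + 2hb·d₀·P(Q,oL,a₃∉L)`)
  and `C = (2S−Z)D₁M_LH + G₂M_LN − 2(S−Z)D₁M_HL + G₃M_HN + Z·D₁·P(bH,oH,a₃∉H)` the second — a
  polynomial identity in the fifteen cells (`RootLeafBAtoms1/2`) after the two-world rewrites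
  (`RootLeafBEvents`, the `Q`-masses from `RootLeafA3` with the attachment vertex `b`).
* The signs: **(L1)** `e₀·P(bH,a₃∉H) ≤ d₀·P(oH,bH,a₃∉H)` = BHK06 1.3 (`bhk_same_cluster_events`);
  **(L2)** `d₀·M_HL ≤ e₀·X_L` and **(★c)** `D₁·M_HL ≤ X_L·M_HN` = BHK06 1.4 with avoidance
  (`bhk_cross_cluster_avoid`: explore `C(a₃)` avoiding `a₂`, resp. `C(a₂)` avoiding `{b, a₃}`);
  **(P1′)** `(M_LN + M_HN)·P(bH,a₃∉H) ≤ D₁·P(bH,oH,a₃∉H)` = explore `C(a₃)` avoiding `{b, a₂}`,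
  Harris in the residual for `{b ↔ a₂}` and `{o ↔ a₂ ∨ o ↔ b}`, BHK06 1.1 (`bhk_induced`) for the
  two decreasing residual functionals; **`Cform_decomp`**: `C = N + Z·slack(P1′) + 2(S−Z)·slack(★c)`
  with `N ≥ 0` (a `ring` identity in the cells).
* **`HCov_root_leaf_b`** assembles them; **`HCov_root_leaf_b'`** is the root-swapped form.
-/

namespace Summit.Ventures.PercRepro2

open UnionCluster CovForm PendantRoot RootLeafO

namespace RootLeafB

variable {V : Type*} {E : Type*} [Fintype E] [DecidableEq E] {R : Type*} [Field R]
  [LinearOrder R] [IsStrictOrderedRing R]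

/-! ## The identity -/

section MainB

variable [Fintype V] [DecidableEq V] (p : E → R) (ends : E → Sym2 V)

omit [LinearOrder R] [IsStrictOrderedRing R] in
omit [LinearOrder R] [IsStrictOrderedRing R] in
/-- **The root-leaf identity at `b`** (p4 g2, S3 (G4-b), proofs/P4-ROOTLEAF-B.md §3): with the
root `a₁` a leaf at `b` through `f` (`q = p f`), `S = P(Ω)`, in the `(b, a₂)`-world of `G − a₁`
(`Q = {b ↮ a₂}`, `Z = P(Q)`, `D₁ = P(Q, a₃ ∈ N)`, `X_L = P(Q, a₃ ∈ L)`, `X_H = P(Q, a₃ ∈ H)`,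
`M_st = P(Q, o ∈ s, a₃ ∈ t)`; `d₀ = P(a₃ ↮ a₂)`, `e₀ = P(o ↔ a₂, a₃ ↮ a₂)`, `hb = P(b ↔ a₂)`):

`S·Gc = q(1−q)²·S·U + q²(1−q)·2·S·C`,
`U = 2S[d₀·P(oH, bH, a₃∉H) − e₀·P(bH, a₃∉H)] + 2hb[e₀·X_L − d₀·M_HL] + 2S·d₀·M_LH + 2hb·d₀·P(Q, o ∈ L, a₃ ∉ L)`
(p4 g0's first coefficient) and
`C = (2S − Z)D₁M_LH + G₂M_LN − 2(S − Z)D₁M_HL + G₃M_HN + Z·D₁·P(bH, oH, a₃∉H)`,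
`G₂ = (S − Z)(Z − 2X_H) + Z·P(bH, a₃H)`, `G₃ = (S − Z)(X_L − D₁ − X_H) + Z·P(bH, a₃H)`
(the second coefficient), a polynomial identity in the fifteen cell masses. -/
theorem Gc_root_leaf_b {f : E} {a₁ b : V} (hf : ends f = s(a₁, b))
    (hleaf : ∀ e, a₁ ∈ ends e → e = f) (h1b : a₁ ≠ b) {o a₂ a₃ : V} (h12 : a₁ ≠ a₂)
    (h13 : a₁ ≠ a₃) (ho : o ≠ a₁) :
    prob p Set.univ * Gc p ends o a₁ a₂ a₃ b =
      p f * (1 - p f) ^ 2 * (prob p Set.univ *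
        (2 * prob p Set.univ * (prob p (avoidAll ends a₂ {a₃}) *
              prob p (connEvent ends o a₂ ∩ connEvent ends a₂ b ∩ (connEvent ends a₂ a₃)ᶜ) -
            prob p (connEvent ends o a₂ ∩ (connEvent ends a₂ a₃)ᶜ) *
              prob p (connEvent ends a₂ b ∩ (connEvent ends a₂ a₃)ᶜ)) +
          2 * prob p (connEvent ends a₂ b) *
            (prob p (connEvent ends o a₂ ∩ (connEvent ends a₂ a₃)ᶜ) * prob p (TEvent ends a₂ b a₃) -
              prob p (avoidAll ends a₂ {a₃}) * prob p (TEvent ends a₂ b a₃ ∩ connEvent ends a₂ o)) +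
          2 * prob p Set.univ * prob p (avoidAll ends a₂ {a₃}) *
            prob p (TEvent ends b a₂ a₃ ∩ connEvent ends b o) +
          2 * prob p (connEvent ends a₂ b) * prob p (avoidAll ends a₂ {a₃}) *
            prob p (avoidAll ends a₂ {b} ∩ connEvent ends b o ∩ (connEvent ends b a₃)ᶜ))) +
      p f ^ 2 * (1 - p f) * (2 * prob p Set.univ *
        ((2 * prob p Set.univ - prob p (avoidAll ends a₂ {b})) * prob p (PDEvent ends b a₂ a₃) *
            prob p (TEvent ends b a₂ a₃ ∩ connEvent ends b o) +
          ((prob p Set.univ - prob p (avoidAll ends a₂ {b})) *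
              (prob p (avoidAll ends a₂ {b}) - 2 * prob p (TEvent ends b a₂ a₃)) +
            prob p (avoidAll ends a₂ {b}) * prob p (connEvent ends a₂ a₃ ∩ connEvent ends a₂ b)) *
            prob p (PDEvent ends b a₂ a₃ ∩ connEvent ends b o) -
          2 * (prob p Set.univ - prob p (avoidAll ends a₂ {b})) * prob p (PDEvent ends b a₂ a₃) *
            prob p (TEvent ends a₂ b a₃ ∩ connEvent ends a₂ o) +
          ((prob p Set.univ - prob p (avoidAll ends a₂ {b})) *
              (prob p (TEvent ends a₂ b a₃) - prob p (PDEvent ends b a₂ a₃) -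
                prob p (TEvent ends b a₂ a₃)) +
            prob p (avoidAll ends a₂ {b}) * prob p (connEvent ends a₂ a₃ ∩ connEvent ends a₂ b)) *
            prob p (PDEvent ends b a₂ a₃ ∩ connEvent ends a₂ o) +
          prob p (avoidAll ends a₂ {b}) * prob p (PDEvent ends b a₂ a₃) *
            prob p (connEvent ends o a₂ ∩ connEvent ends a₂ b ∩ (connEvent ends a₂ a₃)ᶜ))) := by
  have h21 : a₂ ≠ a₁ := Ne.symm h12
  have hb : b ≠ a₁ := Ne.symm h1b
  have c₂o : Free f (connEvent ends a₂ o) := free_connEvent hf hleaf h1b h21 ho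
  have c₂b : Free f (connEvent ends a₂ b) := free_connEvent hf hleaf h1b h21 hb
  unfold Gc DEF EQbo EQb3 EQb3o EQo EQ3 EQ3o PDb PDbo Do gap
  rw [RootLeafA3.prob_Q p hf hleaf h1b h12,
    RootLeafA3.prob_Q_inter_LL p hf hleaf h1b h12 ho hb,
    RootLeafA3.prob_Q_inter p hf hleaf h1b h12 (c₂o.inter c₂b),
    RootLeafA3.prob_Q_inter_R p hf hleaf h1b h12 hb c₂o,
    RootLeafA3.prob_Q_inter_L p hf hleaf h1b h12 ho c₂b,
    RootLeafA3.prob_Q_inter_L₀ p hf hleaf h1b h12 ho, RootLeafA3.prob_Q_inter p hf hleaf h1b h12 c₂o,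
    prob_T'_inter_L₀ p hf hleaf h1b h12 h13 hb, prob_T_inter p hf hleaf h1b h12 h13 c₂b,
    prob_T_inter_L₀ p hf hleaf h1b h12 h13 hb, prob_T'_inter p hf hleaf h1b h12 h13 c₂b,
    prob_T'_inter_LL p hf hleaf h1b h12 h13 ho hb, prob_T'_inter_R p hf hleaf h1b h12 h13 hb c₂o,
    prob_T_inter_L p hf hleaf h1b h12 h13 ho c₂b, prob_T_inter p hf hleaf h1b h12 h13 (c₂o.inter c₂b),
    prob_T_inter_LL p hf hleaf h1b h12 h13 ho hb, prob_T_inter_R p hf hleaf h1b h12 h13 hb c₂o,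
    prob_T'_inter_L p hf hleaf h1b h12 h13 ho c₂b,
    prob_T'_inter p hf hleaf h1b h12 h13 (c₂o.inter c₂b),
    prob_T' p hf hleaf h1b h12 h13, prob_T p hf hleaf h1b h12 h13,
    prob_T'_inter_L₀ p hf hleaf h1b h12 h13 ho, prob_T'_inter p hf hleaf h1b h12 h13 c₂o,
    prob_T_inter_L₀ p hf hleaf h1b h12 h13 ho, prob_T_inter p hf hleaf h1b h12 h13 c₂o,
    prob_PD_inter_L₀ p hf hleaf h1b h12 h13 hb, prob_PD_inter p hf hleaf h1b h12 h13 c₂b,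
    prob_PD_inter_LL p hf hleaf h1b h12 h13 ho hb, prob_PD_inter_R p hf hleaf h1b h12 h13 hb c₂o,
    prob_PD_inter_L p hf hleaf h1b h12 h13 ho c₂b,
    prob_PD_inter p hf hleaf h1b h12 h13 (c₂o.inter c₂b),
    prob_PD_inter_L₀ p hf hleaf h1b h12 h13 ho, prob_PD_inter p hf hleaf h1b h12 h13 c₂o,
    prob_PD p hf hleaf h1b h12 h13, RootLeafA3.prob_conn_leaf p hf hleaf h1b hb]
  simp only [RootLeafO.connEvent_self ends b, Set.inter_univ]
  simp only [cellsB_Qb p ends o a₂ a₃ b,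
    cellsB_Qb_bo p ends o a₂ a₃ b,
    cellsB_Qb_a2o_a2b p ends o a₂ a₃ b,
    cellsB_Qb_a2o p ends o a₂ a₃ b,
    cellsB_Qb_bo_a2b p ends o a₂ a₃ b,
    cellsB_Qb_bo_cnL p ends o a₂ a₃ b,
    cellsB_PD1b p ends o a₂ a₃ b,
    cellsB_PD1b_bo p ends o a₂ a₃ b,
    cellsB_PD1b_a2o p ends o a₂ a₃ b,
    cellsB_PD1b_a2b p ends o a₂ a₃ b,
    cellsB_PD1b_bo_a2b p ends o a₂ a₃ b,
    cellsB_PD1b_a2o_a2b p ends o a₂ a₃ b,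
    cellsB_T1b p ends o a₂ a₃ b,
    cellsB_T1b_bo p ends o a₂ a₃ b,
    cellsB_T1b_a2o p ends o a₂ a₃ b,
    cellsB_T1b_a2b p ends o a₂ a₃ b,
    cellsB_T1b_bo_a2b p ends o a₂ a₃ b,
    cellsB_T1b_a2o_a2b p ends o a₂ a₃ b,
    cellsB_Tp1b p ends o a₂ a₃ b,
    cellsB_Tp1b_bo p ends o a₂ a₃ b,
    cellsB_Tp1b_a2o p ends o a₂ a₃ b,
    cellsB_Tp1b_a2b p ends o a₂ a₃ b,
    cellsB_Tp1b_bo_a2b p ends o a₂ a₃ b,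
    cellsB_Tp1b_a2o_a2b p ends o a₂ a₃ b,
    cellsB_univ p ends o a₂ a₃ b,
    cellsB_N3 p ends o a₂ a₃ b,
    cellsB_N3_a2o p ends o a₂ a₃ b,
    cellsB_N3_a2b p ends o a₂ a₃ b,
    cellsB_N3_a2o_a2b p ends o a₂ a₃ b,
    cellsB_a2o_a2b p ends o a₂ a₃ b,
    cellsB_H3_a2b p ends o a₂ a₃ b,
    cellsB_H3_a2o_a2b p ends o a₂ a₃ b,
    cellsB_a2o p ends o a₂ a₃ b,
    cellsB_H3 p ends o a₂ a₃ b,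
    cellsB_H3_a2o p ends o a₂ a₃ b,
    cellsB_a2b p ends o a₂ a₃ b,
    cellsB_e0 p ends o a₂ a₃ b,
    cellsB_oa2_a2b_cnH p ends o a₂ a₃ b,
    cellsB_a2b_cnH p ends o a₂ a₃ b]
  ring

end MainB

end RootLeafB

end Summit.Ventures.PercRepro2
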